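import Summits.ResolutionOfSingularities.ResolutionOfSingularities.Theorems.PurelyInseparableDim4HopRegionsLocalEscapeUniform
import Summits.ResolutionOfSingularities.ResolutionOfSingularities.Theorems.PurelyInseparableDim4LoopELocalEscape
import HarnessLib

/-!
# [OURS · res-dim4-pi · F4-C-loc] LOOP-E / LOOP-E′ in the LOCAL game over EVERY field of characteristic 3:
  the roots `e0`, `e1`, `e4` (`g0`, `g1`, `g4`) are A-wins for the lone plane over all `L`; at `e2` (`g2`) the
  only `L`-reply is the chart origin `↦ e3` (`g3`), where the `𝔽₃` certificate does NOT lift (`𝔽₉` replies)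

Cell `res-dim4-pi` (D-0157 DOOR 2, wave 2), seat `res-dim4-p-6` g2; WORD #66 (3)(a) continued: lifts the `𝔽₃`
local win certificate `loopE_localWins` / `loopE'_localWins` (p668190, `decide` over `ZMod 3`) of res-dim4-p-8 g2's
LOOP-E region `LoopC.e0 … e4` and its `x₂`-free twin `g0 … g4` (p664169) to every field `L` of characteristic 3, with
the uniform tools (`UniformNoReply`, p667095: maximal witnesses / single sources; base change `liftState`).

* §0 two generic bricks: `step_origin_lift` (the chart-ORIGIN reply commutes with the lift, child computed by p-13's
  `stepD`) and the Boolean **`forcesOriginB`** + `local_reply_eq_zero_of_forcesOriginB`: for a PLANE centre a single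
  source `x^e ↦ x^γ` whose only moving coordinate carries a binomial `C(eᵢ,γᵢ)` prime to 3 makes the `x^γ`-coefficient
  of the point transform `c · βᵈ` (`c ≠ 0`, `d ≥ 1`), so an equimultiple `L`-point over the current point IS the origin.
* §1 certificates (‖ K over `𝔽₃`): at `e0`/`e4` (`F = eL0`, plane `V(x₁,x₄)`) both charts force the origin
  (`x₁x₄² ↦ x₁`: `β²`; `x₁²x₄ ↦ x₄`: `β²`); the children `e1` and `stepD … 3 0 e0` have maximal witnesses in both
  charts (and the latter is in scope by the transversal pair `x₄ / x₁²`); at `e2` the `x₁`-chart forces the origin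
  (`x₁x₃⁴ ↦ x₁`: `β⁴`, child `e3`) and the `x₃`-chart has the maximal witness `x₃`; identically for `g0 … g4`.
* §2 over every `L`: **`rWins_e0/e1/e4_allFields`**, **`rWins_g0/g1/g4_allFields`**, and the reductions
  **`rWins_e2_allFields_of_e3`**, **`rWins_g2_allFields_of_g3`** (from `e2` the lone plane wins over `L` iff it wins
  from the lifted `e3`).  At `e3`/`g3` the `x₁²`-coefficient in the `x₁`-chart is `β² + β⁴ = β²(1+β²)` (and `β + β³`
  in the `x₃`-chart): over any `L ∋ i`, `i² = −1`, the points `β = ±i` ARE equimultiple local replies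
  (`UniformNoReply.exists_nonorigin_local_reply_e3`, p670166) — the `𝔽₃` certificate is honestly `𝔽₃`-only there, and
  whether A still wins the local game from the lifted `e3` over `𝔽₉` is NOT decided here.

Scope (honest): the LOCAL game `RWins 3 localB`; statements about OUR frame at located states; F4-C-loc(3,3) in its
∃-rule form stays OPEN.  [OURS · counted 0 · kernel certificates + symbolic coefficient law; AI kernel work, weaker than
expert review.]  NOTHING here is a statement about resolution of singularities; resolution in dimension `≥ 4` /
characteristic `p > 0` is NOT proved by anything in this file.  bears_on: LADDER-RESOLUTION:D157-DOOR2 (res-dim4-pi ·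
F4-C-loc(3,3) all fields · C-LOOP-E).  Host item (DR-157-C): `stmt-ResolutionOfSingularities-16155`, helper.
-/

set_option linter.dupNamespace false -- mandated namespace of this single-conjunct summit

noncomputable section

open MvPolynomial Finset
open scoped BigOperators

namespace Summit.ResolutionOfSingularities.ResolutionOfSingularities.Theorems.PIDim4

namespace LoopCLocal

open Literature.AlgebraicGeometry.Resolution
open Literature.AlgebraicGeometry.Resolution.CentreBlowup
open StepKit LoopC UniformNoReply

/-! ## §0 Two generic bricks -/

section Generic

variable (L : Type) [Field L] [CharP L 3]

/-- **The chart-origin reply commutes with the lift**: over `L` the origin child of a lifted presented state is the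
lift of p-13's computed child `stepD … 0 s`. OURS. [folklore] -/
theorem step_origin_lift [DecidableEq L] (S : Finset (Fin 4)) (j : Fin 4) (s : SData 4 (ZMod 3)) :
    CentreBlowup.step 3 S j (0 : Fin 4 → L) (liftState L s.toState) = liftState L (stepD 3 S j 0 s).toState := by
  rw [liftState, step_baseChange_zero (φ3 L) 3 S j s.toState, step_toState]
  rfl

/-- **Origin-forcing certificate** (plane centres): `x^e` is the single source of the low monomial `x^γ` for points
vanishing off `T = S ∖ {j}`, `T` has at most one element, and on `T` the exponent drops (`γᵢ < eᵢ`) with a binomial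
`C(eᵢ,γᵢ)` prime to `3`. OURS. [folklore] -/
def forcesOriginB (q : ℕ) (S : Finset (Fin 4)) (j : Fin 4) (F : Terms 4 (ZMod 3)) (γ e : Fin 4 → ℕ) : Bool :=
  singleSourceB q S j (S.erase j) F γ e &&
    decide (∀ m, m ∉ S.erase j → γ m = e m) &&
    decide (∀ i ∈ S.erase j, γ i < e i ∧ ¬ 3 ∣ (e i).choose (γ i)) &&
    decide (∀ i ∈ S.erase j, ∀ i' ∈ S.erase j, i = i')

/-- **An origin-forcing certificate makes every equimultiple `L`-point over the current point the chart origin**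
(the `x^γ`-coefficient of the point transform is `c · βᵈ`, `c ≠ 0` in characteristic 3, `d ≥ 1`). OURS. [folklore] -/
theorem local_reply_eq_zero_of_forcesOriginB {q : ℕ} {S : Finset (Fin 4)} {j : Fin 4} {s : SData 4 (ZMod 3)}
    {γ e : Fin 4 → ℕ} (h : forcesOriginB q S j s.L γ e = true) {b : Fin 4 → L} (hbj : b j = 0)
    (hb : ∀ m : Fin 4, m ∉ S → b m = 0) (heq : IsEquimultiplePoint q S j b (liftState L s.toState)) : b = 0 := by
  simp only [forcesOriginB, Bool.and_eq_true, decide_eq_true_eq] at h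
  obtain ⟨⟨⟨hss, hoff⟩, hdeg⟩, hT⟩ := h
  have hvan := vanish_erase L hbj hb
  have hprod := prod_eq_zero_of_isEquimultiplePoint_of_singleSourceB (φ3 L) hss hvan heq
  obtain ⟨i, -, hi⟩ := Finset.prod_eq_zero_iff.mp hprod
  have hiT : i ∈ S.erase j := by
    by_contra hiT
    rw [hoff i hiT, Nat.sub_self, pow_zero, mul_one, Nat.choose_self, Nat.cast_one] at hi
    exact one_ne_zero hi
  obtain ⟨hlt, hndvd⟩ := hdeg i hiT
  have hC : (((e i).choose (γ i) : ℕ) : L) ≠ 0 := fun h0 => hndvd ((CharP.cast_eq_zero_iff L 3 _).mp h0)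
  have hbi : b i = 0 :=
    (pow_eq_zero_iff (Nat.sub_ne_zero_of_lt hlt)).mp ((mul_eq_zero.mp hi).resolve_left hC)
  funext m
  by_cases hm : m ∈ S.erase j
  · rw [hT m hm i hiT]
    exact hbi
  · exact hvan m hm

end Generic

/-! ## §1 The certificates over `𝔽₃` -/

/-- `e0`/`e4` (`F = eL0`), plane `V(x₁,x₄)`, `x₁`-chart: `x₁` has the single source `x₁x₄²` — coefficient `β²`.
[OURS · ‖ K] -/
theorem fo_eL0_x1 : forcesOriginB 3 {0, 3} 0 eL0 ![1, 0, 0, 0] ![1, 0, 0, 2] = true := by decide +kernel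

/-- `e0`/`e4`, `x₄`-chart: `x₄` has the single source `x₁²x₄` — coefficient `β²`. [OURS · ‖ K] -/
theorem fo_eL0_x4 : forcesOriginB 3 {0, 3} 3 eL0 ![0, 0, 0, 1] ![2, 0, 0, 1] = true := by decide +kernel

/-- `e2` (`F = eL2`), plane `V(x₁,x₃)`, `x₁`-chart: `x₁` has the single source `x₁x₃⁴` — coefficient `β⁴`.
[OURS · ‖ K] -/
theorem fo_eL2_x1 : forcesOriginB 3 {0, 2} 0 eL2 ![1, 0, 0, 0] ![1, 0, 4, 0] = true := by decide +kernel

/-- `e2`, `x₃`-chart: maximal witness `x₃`. [OURS · ‖ K] -/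
theorem w_eL2_x3 : uniformWitnessB 3 {0, 2} 2 (({0, 2} : Finset (Fin 4)).erase 2) eL2 ![0, 0, 1, 0] = true := by
  decide +kernel

/-- `e1` (`F = eL1`), plane `V(x₁,x₄)`: maximal witnesses `x₄²` / `x₁`. [OURS · ‖ K] -/
theorem w_eL1 : ∀ j ∈ ({0, 3} : Finset (Fin 4)),
    uniformWitnessB 3 {0, 3} j (({0, 3} : Finset (Fin 4)).erase j) eL1
      (![![0, 0, 0, 2], ![0, 0, 0, 0], ![0, 0, 0, 0], ![1, 0, 0, 0]] j) = true := by decide +kernel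

/-- the `x₄`-chart origin child of `e0`, plane `V(x₁,x₄)`: maximal witnesses `x₄` / `x₁²`. [OURS · ‖ K] -/
theorem w_e0c3 : ∀ j ∈ ({0, 3} : Finset (Fin 4)),
    uniformWitnessB 3 {0, 3} j (({0, 3} : Finset (Fin 4)).erase j) (stepD 3 {0, 3} 3 0 e0).L
      (![![0, 0, 0, 1], ![0, 0, 0, 0], ![0, 0, 0, 0], ![2, 0, 0, 0]] j) = true := by decide +kernel

/-- … and it is in the coordinate scope (transversal pair `∂_{x₄} ↦ x₁²·unit`, `∂_{x₁}² ↦ x₄·unit`). [OURS · ‖ K] -/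
theorem scope_e0c3 :
    scopeCertB 3 (stepD 3 {0, 3} 3 0 e0).L [(![0, 0, 0, 1], ![2, 0, 0, 0]), (![2, 0, 0, 0], ![0, 0, 0, 1])] = true := by
  decide +kernel

/-- the `x₄`-chart origin child of `e4` has the same polynomial: same witnesses. [OURS · ‖ K] -/
theorem w_e4c3 : ∀ j ∈ ({0, 3} : Finset (Fin 4)),
    uniformWitnessB 3 {0, 3} j (({0, 3} : Finset (Fin 4)).erase j) (stepD 3 {0, 3} 3 0 e4).L
      (![![0, 0, 0, 1], ![0, 0, 0, 0], ![0, 0, 0, 0], ![2, 0, 0, 0]] j) = true := by decide +kernel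

/-- … and the same scope certificate. [OURS · ‖ K] -/
theorem scope_e4c3 :
    scopeCertB 3 (stepD 3 {0, 3} 3 0 e4).L [(![0, 0, 0, 1], ![2, 0, 0, 0]), (![2, 0, 0, 0], ![0, 0, 0, 1])] = true := by
  decide +kernel

/-- the `x₁`-chart origin children of `e0` and `e4` are p-8's `e1`; that of `e2` is `e3`. [OURS · ‖ K] -/
theorem originChildren_e :
    (stepD 3 {0, 3} 0 0 e0).equivB e1 = true ∧ (stepD 3 {0, 3} 0 0 e4).equivB e1 = true ∧
      (stepD 3 {0, 2} 0 0 e2).equivB e3 = true := by decide +kernel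

/-- LOOP-E′ (`x₂`-free): the same certificates for `gL0`, `gL2`, `gL1` and the `x₄`-chart children. [OURS · ‖ K] -/
theorem certs_g :
    forcesOriginB 3 {0, 3} 0 gL0 ![1, 0, 0, 0] ![1, 0, 0, 2] = true ∧
    forcesOriginB 3 {0, 3} 3 gL0 ![0, 0, 0, 1] ![2, 0, 0, 1] = true ∧
    forcesOriginB 3 {0, 2} 0 gL2 ![1, 0, 0, 0] ![1, 0, 4, 0] = true ∧
    uniformWitnessB 3 {0, 2} 2 (({0, 2} : Finset (Fin 4)).erase 2) gL2 ![0, 0, 1, 0] = true ∧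
    (∀ j ∈ ({0, 3} : Finset (Fin 4)), uniformWitnessB 3 {0, 3} j (({0, 3} : Finset (Fin 4)).erase j) gL1
      (![![0, 0, 0, 2], ![0, 0, 0, 0], ![0, 0, 0, 0], ![1, 0, 0, 0]] j) = true) ∧
    (∀ j ∈ ({0, 3} : Finset (Fin 4)), uniformWitnessB 3 {0, 3} j (({0, 3} : Finset (Fin 4)).erase j)
      (stepD 3 {0, 3} 3 0 g0).L (![![0, 0, 0, 1], ![0, 0, 0, 0], ![0, 0, 0, 0], ![2, 0, 0, 0]] j) = true) ∧
    (∀ j ∈ ({0, 3} : Finset (Fin 4)), uniformWitnessB 3 {0, 3} j (({0, 3} : Finset (Fin 4)).erase j)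
      (stepD 3 {0, 3} 3 0 g4).L (![![0, 0, 0, 1], ![0, 0, 0, 0], ![0, 0, 0, 0], ![2, 0, 0, 0]] j) = true) ∧
    scopeCertB 3 (stepD 3 {0, 3} 3 0 g0).L [(![0, 0, 0, 1], ![2, 0, 0, 0]), (![2, 0, 0, 0], ![0, 0, 0, 1])] = true ∧
    scopeCertB 3 (stepD 3 {0, 3} 3 0 g4).L [(![0, 0, 0, 1], ![2, 0, 0, 0]), (![2, 0, 0, 0], ![0, 0, 0, 1])] = true ∧
    (stepD 3 {0, 3} 0 0 g0).equivB g1 = true ∧ (stepD 3 {0, 3} 0 0 g4).equivB g1 = true ∧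
    (stepD 3 {0, 2} 0 0 g2).equivB g3 = true := by
  refine ⟨?_, ?_, ?_, ?_, ?_, ?_, ?_, ?_, ?_, ?_, ?_, ?_⟩ <;> decide +kernel

/-! ## §2 Over every field of characteristic 3 -/

section AllFields

variable (L : Type) [Field L] [CharP L 3] [DecidableEq L]

/-- **`e1` is a local A-win over every field of characteristic 3** (play `V(x₁,x₄)`: no `L`-reply). [OURS · ‖ K] -/
theorem rWins_e1_allFields : RWins 3 localB (liftState L e1.toState) :=
  rWins_allFields_of_witnesses L (inCoordinateScope_toState_of_scopeCertB scope_eL1) (by decide +kernel) _ w_eL1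

/-- **A plane root whose two charts force the origin**: if both chart-origin children are local A-wins over `L`, so
is the root (play the plane). OURS. [folklore] -/
theorem rWins_lift_of_forcesOrigin_pair {a c : Fin 4} {s : SData 4 (ZMod 3)}
    (hscope : InCoordinateScope 3 s.toState.F) (hperm : permB 3 {a, c} s.L = true) {γa ea γc ec : Fin 4 → ℕ}
    (ha : forcesOriginB 3 {a, c} a s.L γa ea = true) (hc : forcesOriginB 3 {a, c} c s.L γc ec = true)
    (hwa : RWins 3 localB (liftState L (stepD 3 {a, c} a 0 s).toState))
    (hwc : RWins 3 localB (liftState L (stepD 3 {a, c} c 0 s).toState)) : RWins 3 localB (liftState L s.toState) := by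
  refine Game.Wins.move (m := ({a, c} : Finset (Fin 4))) (legal_lift L hscope hperm) ?_
  rintro s' ⟨j, b, hj, hbj, hloc, heq, -, rfl⟩
  have hb := (localB_eq_true_iff _ j b).mp hloc
  rcases mem_pair hj with rfl | rfl
  · obtain rfl := local_reply_eq_zero_of_forcesOriginB L ha hbj hb heq
    rw [step_origin_lift]
    exact hwa
  · obtain rfl := local_reply_eq_zero_of_forcesOriginB L hc hbj hb heq
    rw [step_origin_lift]
    exact hwc

/-- **`e0` is a local A-win over EVERY field of characteristic 3, in two moves**: play `V(x₁,x₄)`; an equimultiple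
`L`-point over the current point is a chart origin (`β² = 0`); the children `e1` / `stepD … 3 0 e0` have no `L`-reply
to the same plane. [OURS · ‖ K] -/
theorem rWins_e0_allFields : RWins 3 localB (liftState L e0.toState) := by
  refine rWins_lift_of_forcesOrigin_pair L (inCoordinateScope_toState_of_scopeCertB scope_eL0) (by decide +kernel)
    fo_eL0_x1 fo_eL0_x4 ?_ ?_
  · rw [(toState_eq_iff _ _).mpr originChildren_e.1]
    exact rWins_e1_allFields L
  · exact rWins_allFields_of_witnesses L (inCoordinateScope_toState_of_scopeCertB scope_e0c3) (by decide +kernel)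
      _ w_e0c3

/-- **`e4` (same polynomial as `e0`, other decorations) is a local A-win over every field of characteristic 3.**
[OURS · ‖ K] -/
theorem rWins_e4_allFields : RWins 3 localB (liftState L e4.toState) := by
  refine rWins_lift_of_forcesOrigin_pair L (inCoordinateScope_toState_of_scopeCertB (scope_eL0 : scopeCertB 3 e4.L _ = _))
    (by decide +kernel) fo_eL0_x1 fo_eL0_x4 ?_ ?_
  · rw [(toState_eq_iff _ _).mpr originChildren_e.2.1]
    exact rWins_e1_allFields L
  · exact rWins_allFields_of_witnesses L (inCoordinateScope_toState_of_scopeCertB scope_e4c3) (by decide +kernel)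
      _ w_e4c3

/-- **At `e2` the local game over `L` reduces to the lifted `e3`**: play `V(x₁,x₃)`; the `x₃`-chart has no
`L`-reply (witness `x₃`), the `x₁`-chart forces the origin (`β⁴ = 0`), whose child is `e3`. [OURS · ‖ K] -/
theorem rWins_e2_allFields_of_e3 (h3 : RWins 3 localB (liftState L e3.toState)) :
    RWins 3 localB (liftState L e2.toState) := by
  refine Game.Wins.move (m := ({0, 2} : Finset (Fin 4)))
    (legal_lift L (inCoordinateScope_toState_of_scopeCertB scope_eL2) (by decide +kernel)) ?_
  rintro s' ⟨j, b, hj, hbj, hloc, heq, -, rfl⟩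
  have hb := (localB_eq_true_iff _ j b).mp hloc
  rcases mem_pair hj with rfl | rfl
  · obtain rfl := local_reply_eq_zero_of_forcesOriginB L (s := e2) fo_eL2_x1 hbj hb heq
    rw [step_origin_lift, (toState_eq_iff _ _).mpr originChildren_e.2.2]
    exact h3
  · exact absurd heq (not_isEquimultiplePoint_of_uniformWitnessB (φ3 L) w_eL2_x3 (vanish_erase L hbj hb))

/-- **LOOP-E′: `g1` is a local A-win over every field of characteristic 3.** [OURS · ‖ K] -/
theorem rWins_g1_allFields : RWins 3 localB (liftState L g1.toState) :=
  rWins_allFields_of_witnesses L (inCoordinateScope_toState_of_scopeCertB scope_gL1) (by decide +kernel) _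
    certs_g.2.2.2.2.1

/-- **LOOP-E′: `g0` is a local A-win over every field of characteristic 3.** [OURS · ‖ K] -/
theorem rWins_g0_allFields : RWins 3 localB (liftState L g0.toState) := by
  refine rWins_lift_of_forcesOrigin_pair L (inCoordinateScope_toState_of_scopeCertB scope_gL0) (by decide +kernel)
    certs_g.1 certs_g.2.1 ?_ ?_
  · rw [(toState_eq_iff _ _).mpr certs_g.2.2.2.2.2.2.2.2.2.1]
    exact rWins_g1_allFields L
  · exact rWins_allFields_of_witnesses L (inCoordinateScope_toState_of_scopeCertB certs_g.2.2.2.2.2.2.2.1)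
      (by decide +kernel) _ certs_g.2.2.2.2.2.1

/-- **LOOP-E′: `g4` is a local A-win over every field of characteristic 3.** [OURS · ‖ K] -/
theorem rWins_g4_allFields : RWins 3 localB (liftState L g4.toState) := by
  refine rWins_lift_of_forcesOrigin_pair L
    (inCoordinateScope_toState_of_scopeCertB (scope_gL0 : scopeCertB 3 g4.L _ = _)) (by decide +kernel)
    certs_g.1 certs_g.2.1 ?_ ?_
  · rw [(toState_eq_iff _ _).mpr certs_g.2.2.2.2.2.2.2.2.2.2.1]
    exact rWins_g1_allFields L
  · exact rWins_allFields_of_witnesses L (inCoordinateScope_toState_of_scopeCertB certs_g.2.2.2.2.2.2.2.2.1)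
      (by decide +kernel) _ certs_g.2.2.2.2.2.2.1

/-- **LOOP-E′: at `g2` the local game over `L` reduces to the lifted `g3`.** [OURS · ‖ K] -/
theorem rWins_g2_allFields_of_g3 (h3 : RWins 3 localB (liftState L g3.toState)) :
    RWins 3 localB (liftState L g2.toState) := by
  refine Game.Wins.move (m := ({0, 2} : Finset (Fin 4)))
    (legal_lift L (inCoordinateScope_toState_of_scopeCertB scope_gL2) (by decide +kernel)) ?_
  rintro s' ⟨j, b, hj, hbj, hloc, heq, -, rfl⟩
  have hb := (localB_eq_true_iff _ j b).mp hloc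
  rcases mem_pair hj with rfl | rfl
  · obtain rfl := local_reply_eq_zero_of_forcesOriginB L (s := g2) certs_g.2.2.1 hbj hb heq
    rw [step_origin_lift, (toState_eq_iff _ _).mpr certs_g.2.2.2.2.2.2.2.2.2.2.2]
    exact h3
  · exact absurd heq (not_isEquimultiplePoint_of_uniformWitnessB (φ3 L) certs_g.2.2.2.1 (vanish_erase L hbj hb))

/-- **Summary — what of LOOP-E / LOOP-E′ lifts to every field of characteristic 3**: the roots `e0, e1, e4` and
`g0, g1, g4` are local A-wins for the lone plane over every `L`; `e2`/`g2` reduce to `e3`/`g3`, where the `𝔽₃`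
certificate does not lift (`UniformNoReply.exists_nonorigin_local_reply_e3`: `𝔽₉`-replies `β = ±i`). [OURS · ‖ K] -/
theorem loopE_roots_localWins_allFields :
    (RWins 3 localB (liftState L e0.toState) ∧ RWins 3 localB (liftState L e1.toState) ∧
      RWins 3 localB (liftState L e4.toState)) ∧
    (RWins 3 localB (liftState L g0.toState) ∧ RWins 3 localB (liftState L g1.toState) ∧
      RWins 3 localB (liftState L g4.toState)) ∧
    (RWins 3 localB (liftState L e3.toState) → RWins 3 localB (liftState L e2.toState)) ∧
    (RWins 3 localB (liftState L g3.toState) → RWins 3 localB (liftState L g2.toState)) :=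
  ⟨⟨rWins_e0_allFields L, rWins_e1_allFields L, rWins_e4_allFields L⟩,
    ⟨rWins_g0_allFields L, rWins_g1_allFields L, rWins_g4_allFields L⟩,
    rWins_e2_allFields_of_e3 L, rWins_g2_allFields_of_g3 L⟩

end AllFields

end LoopCLocal

end Summit.ResolutionOfSingularities.ResolutionOfSingularities.Theorems.PIDim4

end
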